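import Summits.QuantumFields.YangMills.Theorems.BalabanUVNodesN20FibreDomComposition

/-!
# N20 (NE7b), ITEM (a) OF THE FACE — THE A.E. CURRENCY: one-component letters asked `dV`-ALMOST EVERYWHERE in the configuration compose (a.e. Fubini on the
# finite Haar product) into the INTEGRATED domination, i.e. into def-R's letter on the FULL fibre `Finset.univ` at EVERY configuration — no boundedness, no fibre family

Cell `pub-ymgap`, YM-PLAN Track A (HUMAN RULING D-0062); seat `pub-ymgap-dag-n20-d` (R134 (a) N20 NE7b s3), gen 44 — director-ym №374 line (E), road [e] TOWER-FREE of record (№377).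
`--kind proof --supports stmt-QuantumFields-27366 --as helper` (K3⁸); COUNT-NEUTRAL helper ∕ NOT a discharge; THEOREMS ONLY (0 `def`).  [LF-II] = [Balaban1989LargeFieldII]; [IV] = [Balaban1989LargeFieldI].
Companions BY NAME: `…N20FibreDomComposition` (gen 43, p783663: pointwise letters enlarge and compose; `lmarginal_const_mul_fibre`), def-R's a.e. DEVICE
`B15.BasicStep.ae_ae_eq_comp_symm_of_measurePreserving` (`Node00/ROperationOfRecordEss` §1: a `Measure.pi`-null set has a.e.-null fibre sections) and
`B15.BasicStep.lintegral_lmarginal_ofReal_eq ∕ lmarginal_ofReal_ae_ne_top` (`Node00/RStepProvisosIntOfRecord`), Mathlib `MeasureTheory.lmarginal_union' ∕ lmarginal_univ`.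

WHY (a located CURRENCY defect of this lineage's own faces, and its repair).  ✓p782644 `…_ofRecord` and ✓p784040 `…_ofRecord_perRegion` ask their letters (a) ∕ (a′) — and ✓p784040 its
boundedness rows — AT EVERY configuration `V` on PROPER sub-fibres of the top lattice, i.e. along `dV`-NULL fibres.  But the pieces `χ·dressedSlotsOfDatum₉` carry, at every level
`≥ 1`, def-B's transport factor `margDensity = rnNN …` — Mathlib's `rnDeriv` VERSION, determined `dV`-a.e. only (`T4AveragingDisintegration.margDensity`; `Node00/TStepOfRecord`
«VERSION CAVEAT») —, the same non-determination dag-n13-w2 certified for the (B)-face (`…N13Cor3MargDensityVersionNotDeterminedAtRecord13`); the version slot `Revision₁₃`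
re-chooses the DATUM's densities, not the dressed slots' transport.  So no `dV`-a.e.-invariant estimate — the only kind an analytic proof delivers (law level) — can discharge a
POINTWISE letter on a proper sub-fibre, nor a pointwise sup bound.  THE REPAIR needs no re-run of road [e]: ✓p782644's letter clause has a FREE fibre `fib s`, and at
`fib s := Finset.univ` def-R's `fibreIntegral univ f V = (∫⁻ ofReal∘f dV).toReal` (Mathlib `lmarginal_univ`) IS the integrated — version-robust — domination, which letters holding
`dV`-ALMOST EVERYWHERE on the components' own fibres deliver by a.e. Fubini: (§1) `lmarginal` is a.e.-MONOTONE under `Measure.pi` (def-R's device with `β := Prop`), so an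
a.e. letter on `fib ⊆ U` is an a.e. letter on `U` (`lmarginal_union'`) and a.e. letters along a chain compose; integrating (`lintegral_lmarginal_ofReal_eq`) gives the total
domination, and INTEGRABILITY (a.e. finiteness of the marginals, `lmarginal_ofReal_ae_ne_top`) — not boundedness — moves between def-R's real `fibreIntegral` letters and the
`ℝ≥0∞` marginals almost everywhere.

WHAT IS PROVED (kernel; zero `sorry`).  §1 (generic product measure) ★ `lmarginal_mono_ae` (`f ≤ᵐ[Measure.pi μ] g ⇒ ∫⋯∫⁻_s f ≤ᵐ ∫⋯∫⁻_s g`, ANY `f g`),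
`lmarginal_mono_ae_of_subset`; (over `Setup`) `lmarginal_le_mul_lmarginal_ae_of_subset` (an a.e. letter with a finite factor on `fib ⊆ U` is one on `U`), ★★ `fibreDomAE_chain`
(a.e. letters along a `Fin`-chain compose on the big fibre, `ℝ≥0∞`), `lintegral_le_mul_lintegral_of_lmarginal_le_ae` (… and integrate), `lmarginal_ofReal_le_mul_ae_of_fibreIntegral_le_ae`
(def-R's real a.e. letter ⇒ the `ℝ≥0∞` a.e. letter, under integrability), `fibreIntegral_univ_eq` (the letter on `univ` is the integrated one); §2 ★★★
`fibreIntegral_univ_le_of_chainAE` (real a.e. letters along a chain of integrable measurable densities ⇒ def-R's letter on `Finset.univ` at EVERY configuration with the product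
factor) and ★★★ `integral_le_prod_mul_integral_of_chainAE` (the same as Bochner integrals, for non-negative densities).

HONEST FRAMING.  [a.e. Fubini + bookkeeping]: no estimate.  NOTHING of Bałaban's is asserted; the a.e. one-component letter a consumer supplies is STILL [LF-II] (1.79)∕(1.89)-improved
KIND read relatively on [IV] (0.3)'s fibre — NOT PRINTED for `d = 4` ∕ NOT proved (junction NC-NE7b-α UNRULED); NE7 ∕ NE7b ∕ NE7c NOT proved; K0⁷ ∕ K3⁸ untouched; N20 NOT
discharged; counts UNMOVED (typed 28∕28 · discharged 8∕27); one finite four-torus programme at fixed `ε` — NOT ℝ⁴, NOT OS, NOT a mass gap, NOT the Clay problem.  No `def`, no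
`instance`, no `notation`, no `sorry`; no decl below carries a cite tag.
-/

noncomputable section

open MeasureTheory Function
open scoped BigOperators ENNReal
open Finset

namespace YMDAG.UVSplit

open Literature.MathematicalPhysics.QuantumFieldTheory.Balaban1983to89
open Literature.MathematicalPhysics.QuantumFieldTheory.Balaban1983to89.B15.BasicStep
  (fibreIntegral ofReal_comp_measurable fieldMeasure_eq_pi ae_ae_eq_comp_symm_of_measurePreserving lintegral_lmarginal_eq lintegral_lmarginal_ofReal_eq
    lmarginal_ofReal_ae_ne_top)

/-! ## §1 `lmarginal` is a.e.-monotone under the product measure; a.e. letters enlarge, compose and integrate -/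

section Device

variable {δ : Type*} [DecidableEq δ] [Fintype δ] {X : δ → Type*} [∀ i, MeasurableSpace (X i)]

/-- ★ **`lmarginal` IS A.E.-MONOTONE FOR THE PRODUCT MEASURE**: if `f ≤ g` `Measure.pi μ`-a.e. then `∫⋯∫⁻_s, f ∂μ ≤ ∫⋯∫⁻_s, g ∂μ` `Measure.pi μ`-a.e., for ANY `f g : (Π i, X i) → ℝ≥0∞`
(no measurability) and any `Finset` of coordinates (σ-finite factors) — def-R's device `ae_ae_eq_comp_symm_of_measurePreserving` (a `Measure.pi`-null set has a.e.-null fibre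
sections through `piEquivPiSubtypeProd`) read on the `Prop`-valued function `x ↦ (f x ≤ g x)`, then `lintegral_mono_ae` on the fibre. [bookkeeping] -/
theorem lmarginal_mono_ae (μ : ∀ i, Measure (X i)) [∀ i, SigmaFinite (μ i)] (s : Finset δ) {f g : (∀ i, X i) → ℝ≥0∞}
    (h : f ≤ᵐ[Measure.pi μ] g) : ∫⋯∫⁻_s, f ∂μ ≤ᵐ[Measure.pi μ] ∫⋯∫⁻_s, g ∂μ := by
  have he := measurePreserving_piEquivPiSubtypeProd μ (fun i => i ∈ s)
  -- `lmarginal` reads the `Fintype ↥s` instance `Finset.Subtype.fintype`; align the measure-preserving statement with it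
  rw [(Subsingleton.elim _ _ : Subtype.fintype (fun i => i ∈ s) = Finset.Subtype.fintype s)] at he
  have h' : (fun x => (f x ≤ g x)) =ᵐ[Measure.pi μ] fun _ => True := h.mono fun x hx => eq_true hx
  refine (ae_ae_eq_comp_symm_of_measurePreserving _ he h').mono fun x hx => ?_
  have hupd : ∀ y : ∀ i : s, X i, updateFinset x s y =
      (MeasurableEquiv.piEquivPiSubtypeProd X (fun i => i ∈ s)).symm
        (y, ((MeasurableEquiv.piEquivPiSubtypeProd X (fun i => i ∈ s)) x).2) := fun _ => rfl
  show ∫⁻ y, f (updateFinset x s y) ∂_ ≤ ∫⁻ y, g (updateFinset x s y) ∂_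
  simp only [hupd]
  exact lintegral_mono_ae (hx.mono fun y hy => of_eq_true hy)

/-- **An a.e. letter on a sub-fibre is an a.e. letter on the fibre**: for measurable `f g` and `s ⊆ t`, `∫⋯∫⁻_s f ≤ᵐ ∫⋯∫⁻_s g` gives `∫⋯∫⁻_t f ≤ᵐ ∫⋯∫⁻_t g`
(`∫⋯∫⁻_t = ∫⋯∫⁻_{t∖s}∫⋯∫⁻_s`, Mathlib `lmarginal_union'`, then `lmarginal_mono_ae`). [bookkeeping] -/
theorem lmarginal_mono_ae_of_subset (μ : ∀ i, Measure (X i)) [∀ i, SigmaFinite (μ i)] {s t : Finset δ} (hst : s ⊆ t)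
    {f g : (∀ i, X i) → ℝ≥0∞} (hf : Measurable f) (hg : Measurable g) (h : ∫⋯∫⁻_s, f ∂μ ≤ᵐ[Measure.pi μ] ∫⋯∫⁻_s, g ∂μ) :
    ∫⋯∫⁻_t, f ∂μ ≤ᵐ[Measure.pi μ] ∫⋯∫⁻_t, g ∂μ := by
  rw [← union_sdiff_of_subset hst, lmarginal_union' μ f hf disjoint_sdiff, lmarginal_union' μ g hg disjoint_sdiff]
  exact lmarginal_mono_ae μ _ h

end Device

section Fibre

variable {P : Params} {G : Type*} [GaugeGroup G] [MeasurableSpace G] [HaarData G] {j : ℕ}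

/-- **AN A.E. LETTER WITH A FINITE FACTOR ENLARGES** (over `Setup.fieldMeasure`, the product of the normalised Haar measures): for measurable `F G : GaugeField → ℝ≥0∞`, `c ≠ ∞` and
`fib ⊆ U`, `∫⋯∫⁻_{fib} F ≤ᵐ c·∫⋯∫⁻_{fib} G` gives `∫⋯∫⁻_U F ≤ᵐ c·∫⋯∫⁻_U G` ([LF-II] p. 383 last lines – p. 384 l. 1: the inequality holds «for all large field regions»; here in the
a.e. currency). [bookkeeping] -/
theorem lmarginal_le_mul_lmarginal_ae_of_subset {iP : DecidableEq (PBond P j)} {fib U : Finset (PBond P j)} (hsub : fib ⊆ U)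
    {F G' : GaugeField P j G → ℝ≥0∞} (hF : Measurable F) (hG : Measurable G') {c : ℝ≥0∞} (hc : c ≠ ∞)
    (h : (∫⋯∫⁻_fib, F ∂(fun _ : PBond P j => (HaarData.haar : Measure G))) ≤ᵐ[fieldMeasure P j G]
      fun V => c * (∫⋯∫⁻_fib, G' ∂(fun _ : PBond P j => (HaarData.haar : Measure G))) V) :
    (∫⋯∫⁻_U, F ∂(fun _ : PBond P j => (HaarData.haar : Measure G))) ≤ᵐ[fieldMeasure P j G]
      fun V => c * (∫⋯∫⁻_U, G' ∂(fun _ : PBond P j => (HaarData.haar : Measure G))) V := by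
  have hcG : Measurable fun W => c * G' W := hG.const_mul _
  have h1 : (∫⋯∫⁻_fib, F ∂(fun _ : PBond P j => (HaarData.haar : Measure G))) ≤ᵐ[fieldMeasure P j G]
      ∫⋯∫⁻_fib, (fun W => c * G' W) ∂(fun _ : PBond P j => (HaarData.haar : Measure G)) := by
    rw [lmarginal_const_mul_fibre (iP := iP) fib hc G']
    exact h
  rw [fieldMeasure_eq_pi] at h1 ⊢
  have h2 := lmarginal_mono_ae_of_subset (fun _ : PBond P j => (HaarData.haar : Measure G)) hsub hF hcG h1
  -- come back to the displayed shape (the instance terms of the Mathlib-side marginal agree definitionally, not syntactically)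
  exact h2.mono fun V hV => hV.trans_eq (congrFun (lmarginal_const_mul_fibre (iP := iP) U hc G') V)

omit [GaugeGroup G] [HaarData G] in
/-- **A.E. LETTERS ON A COMMON FIBRE COMPOSE**: `L₀ ≤ᵐ c₁·L₁` and `L₁ ≤ᵐ c₂·L₂` give `L₀ ≤ᵐ (c₁c₂)·L₂`. [bookkeeping] -/
theorem ae_le_mul_trans {μ : Measure (GaugeField P j G)} {L₀ L₁ L₂ : GaugeField P j G → ℝ≥0∞} {c₁ c₂ : ℝ≥0∞}
    (h₁ : L₀ ≤ᵐ[μ] fun V => c₁ * L₁ V) (h₂ : L₁ ≤ᵐ[μ] fun V => c₂ * L₂ V) : L₀ ≤ᵐ[μ] fun V => c₁ * c₂ * L₂ V := by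
  filter_upwards [h₁, h₂] with V hV₁ hV₂
  calc L₀ V ≤ c₁ * L₁ V := hV₁
    _ ≤ c₁ * (c₂ * L₂ V) := by gcongr
    _ = c₁ * c₂ * L₂ V := by rw [mul_assoc]

/-- ★★ **A.E. LETTERS ALONG A CHAIN COMPOSE ON THE BIG FIBRE**: a `Fin`-indexed chain of measurable `F 0, …, F m : GaugeField → ℝ≥0∞`, link fibres `fib i ⊆ U`, finite link factors
`c i`; if every link is an a.e. letter on its own fibre — `∫⋯∫⁻_{fib i} F i ≤ᵐ c i · ∫⋯∫⁻_{fib i} F (i+1)` — then `∫⋯∫⁻_U F 0 ≤ᵐ (Π_i c i) · ∫⋯∫⁻_U F m` ([LF-II] (1.79): the product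
over the components of the factors connected with them, in the a.e. currency; induction on the links). [bookkeeping] -/
theorem fibreDomAE_chain {iP : DecidableEq (PBond P j)} (U : Finset (PBond P j)) :
    ∀ (m : ℕ) (F : Fin (m + 1) → GaugeField P j G → ℝ≥0∞) (fib : Fin m → Finset (PBond P j)) (c : Fin m → ℝ≥0∞),
      (∀ i, fib i ⊆ U) → (∀ k, Measurable (F k)) → (∀ i, c i ≠ ∞) →
      (∀ i : Fin m, (∫⋯∫⁻_(fib i), F i.castSucc ∂(fun _ : PBond P j => (HaarData.haar : Measure G))) ≤ᵐ[fieldMeasure P j G]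
        fun V => c i * (∫⋯∫⁻_(fib i), F i.succ ∂(fun _ : PBond P j => (HaarData.haar : Measure G))) V) →
      (∫⋯∫⁻_U, F 0 ∂(fun _ : PBond P j => (HaarData.haar : Measure G))) ≤ᵐ[fieldMeasure P j G]
        fun V => (∏ i, c i) * (∫⋯∫⁻_U, F (Fin.last m) ∂(fun _ : PBond P j => (HaarData.haar : Measure G))) V := by
  intro m
  induction m with
  | zero =>
      intro F fib c _ _ _ _
      exact Filter.Eventually.of_forall fun V => by simp
  | succ m ih =>
      intro F fib c hsub hm hc hlink
      -- the first link, enlarged to `U`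
      have h0 : (∫⋯∫⁻_U, F 0 ∂(fun _ : PBond P j => (HaarData.haar : Measure G))) ≤ᵐ[fieldMeasure P j G]
          fun V => c 0 * (∫⋯∫⁻_U, F 1 ∂(fun _ : PBond P j => (HaarData.haar : Measure G))) V := by
        have h := lmarginal_le_mul_lmarginal_ae_of_subset (hsub 0) (hm (0 : Fin (m + 1)).castSucc) (hm (0 : Fin (m + 1)).succ) (hc 0) (hlink 0)
        simpa only [Fin.castSucc_zero, Fin.succ_zero_eq_one] using h
      -- the remaining links (induction hypothesis on the shifted chain)
      have ht : (∫⋯∫⁻_U, F 1 ∂(fun _ : PBond P j => (HaarData.haar : Measure G))) ≤ᵐ[fieldMeasure P j G]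
          fun V => (∏ i : Fin m, c i.succ) * (∫⋯∫⁻_U, F (Fin.last (m + 1)) ∂(fun _ : PBond P j => (HaarData.haar : Measure G))) V := by
        have h := ih (fun k => F k.succ) (fun i => fib i.succ) (fun i => c i.succ) (fun i => hsub i.succ) (fun k => hm k.succ) (fun i => hc i.succ)
          (fun i => by simpa only [Fin.succ_castSucc] using hlink i.succ)
        simpa only [Fin.succ_zero_eq_one, Fin.succ_last] using h
      rw [Fin.prod_univ_succ]
      exact ae_le_mul_trans h0 ht

/-- **… AND INTEGRATE**: for measurable `F G'` and `c ≠ ∞`, `∫⋯∫⁻_U F ≤ᵐ c·∫⋯∫⁻_U G'` gives `∫ F dV ≤ c·∫ G' dV` (`∫dV = ∫dV ∫dV⌈_U`, `lintegral_lmarginal_eq` at the normalised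
Haar fibres; `lintegral_mono_ae`). [bookkeeping] -/
theorem lintegral_le_mul_lintegral_of_lmarginal_le_ae {iP : DecidableEq (PBond P j)} (U : Finset (PBond P j)) {F G' : GaugeField P j G → ℝ≥0∞}
    (hF : Measurable F) (hG : Measurable G') {c : ℝ≥0∞}
    (h : (∫⋯∫⁻_U, F ∂(fun _ : PBond P j => (HaarData.haar : Measure G))) ≤ᵐ[fieldMeasure P j G]
      fun V => c * (∫⋯∫⁻_U, G' ∂(fun _ : PBond P j => (HaarData.haar : Measure G))) V) :
    ∫⁻ V, F V ∂fieldMeasure P j G ≤ c * ∫⁻ V, G' V ∂fieldMeasure P j G := by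
  have hIF : ∫⁻ V, (∫⋯∫⁻_U, F ∂(fun _ : PBond P j => (HaarData.haar : Measure G))) V ∂fieldMeasure P j G = ∫⁻ V, F V ∂fieldMeasure P j G := by
    rw [fieldMeasure_eq_pi]; exact lintegral_lmarginal_eq _ U hF
  have hIG : ∫⁻ V, (∫⋯∫⁻_U, G' ∂(fun _ : PBond P j => (HaarData.haar : Measure G))) V ∂fieldMeasure P j G = ∫⁻ V, G' V ∂fieldMeasure P j G := by
    rw [fieldMeasure_eq_pi]; exact lintegral_lmarginal_eq _ U hG
  calc ∫⁻ V, F V ∂fieldMeasure P j G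
      = ∫⁻ V, (∫⋯∫⁻_U, F ∂(fun _ : PBond P j => (HaarData.haar : Measure G))) V ∂fieldMeasure P j G := hIF.symm
    _ ≤ ∫⁻ V, c * (∫⋯∫⁻_U, G' ∂(fun _ : PBond P j => (HaarData.haar : Measure G))) V ∂fieldMeasure P j G := lintegral_mono_ae h
    _ = c * ∫⁻ V, (∫⋯∫⁻_U, G' ∂(fun _ : PBond P j => (HaarData.haar : Measure G))) V ∂fieldMeasure P j G :=
        lintegral_const_mul c (hG.lmarginal _)
    _ = c * ∫⁻ V, G' V ∂fieldMeasure P j G := by rw [hIG]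

/-- **def-R's REAL A.E. LETTER IS THE `ℝ≥0∞` A.E. LETTER** (under INTEGRABILITY, not boundedness): for a measurable integrable `f`, any `g` and `0 ≤ z`, if
`∫⌈_s f ≤ z·∫⌈_s g` `dV`-a.e. (real fibre integrals) then `∫⋯∫⁻_s ofReal∘f ≤ᵐ ofReal z · ∫⋯∫⁻_s ofReal∘g` — the marginal of `f` is finite a.e. (`lmarginal_ofReal_ae_ne_top`),
so `toReal` loses nothing there. [bookkeeping] -/
theorem lmarginal_ofReal_le_mul_ae_of_fibreIntegral_le_ae {iP : DecidableEq (PBond P j)} (s : Finset (PBond P j)) {f g : Density P j G} {z : ℝ}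
    (hf : Measurable f) (hfi : Integrable f (fieldMeasure P j G)) (hz : 0 ≤ z)
    (h : ∀ᵐ V ∂fieldMeasure P j G, fibreIntegral s f V ≤ z * fibreIntegral s g V) :
    (∫⋯∫⁻_s, (fun U => ENNReal.ofReal (f U)) ∂(fun _ : PBond P j => (HaarData.haar : Measure G))) ≤ᵐ[fieldMeasure P j G]
      fun V => ENNReal.ofReal z * (∫⋯∫⁻_s, (fun U => ENNReal.ofReal (g U)) ∂(fun _ : PBond P j => (HaarData.haar : Measure G))) V := by
  filter_upwards [h, lmarginal_ofReal_ae_ne_top s hf hfi.lintegral_lt_top.ne] with V hV hfin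
  set Lf := (∫⋯∫⁻_s, (fun U => ENNReal.ofReal (f U)) ∂(fun _ : PBond P j => (HaarData.haar : Measure G))) V with hLf
  set Lg := (∫⋯∫⁻_s, (fun U => ENNReal.ofReal (g U)) ∂(fun _ : PBond P j => (HaarData.haar : Measure G))) V with hLg
  have h' : Lf.toReal ≤ z * Lg.toReal := hV
  calc Lf = ENNReal.ofReal Lf.toReal := (ENNReal.ofReal_toReal hfin).symm
    _ ≤ ENNReal.ofReal (z * Lg.toReal) := ENNReal.ofReal_le_ofReal h'
    _ = ENNReal.ofReal z * ENNReal.ofReal Lg.toReal := ENNReal.ofReal_mul hz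
    _ ≤ ENNReal.ofReal z * Lg := by gcongr; exact ENNReal.ofReal_toReal_le

/-- **THE LETTER ON THE FULL FIBRE IS THE INTEGRATED ONE**: `∫⌈_{univ} f V = (∫ ofReal∘f dV).toReal` at EVERY configuration (Mathlib `lmarginal_univ`) — the one place where a
pointwise letter is version-robust. [bookkeeping] -/
theorem fibreIntegral_univ_eq {iP : DecidableEq (PBond P j)} (f : Density P j G) (V : GaugeField P j G) :
    fibreIntegral (Finset.univ : Finset (PBond P j)) f V = (∫⁻ W, ENNReal.ofReal (f W) ∂fieldMeasure P j G).toReal := by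
  simp only [fibreIntegral, lmarginal_univ, fieldMeasure_eq_pi]
  rfl

end Fibre

/-! ## §2 From a.e. letters along a chain to def-R's letter on `Finset.univ` at every configuration, and to Bochner integrals -/

section Chain

variable {P : Params} {G : Type*} [GaugeGroup G] [MeasurableSpace G] [HaarData G] {j : ℕ}

/-- ★★★ **A.E. ONE-COMPONENT LETTERS ALONG A CHAIN GIVE THE LETTER ON THE FULL FIBRE AT EVERY CONFIGURATION.**  A chain of measurable INTEGRABLE real densities `f 0, …, f m`, link fibres
`fib i` (any), link factors `0 ≤ z i`; if every link is def-R's letter `dV`-ALMOST EVERYWHERE — `∫⌈_{fib i} f i ≤ z i · ∫⌈_{fib i} f (i+1)` for a.e. `V` — then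
`∫⌈_{univ} f 0 ≤ (Π_i z i) · ∫⌈_{univ} f m` at EVERY `V` (both sides are the total integrals: `fibreIntegral_univ_eq`).  No boundedness and no enclosing fibre family are needed.
This is the socket ✓p782644 `…_ofRecord` consumes at `fib s := Finset.univ`. [bookkeeping] -/
theorem fibreIntegral_univ_le_of_chainAE {iP : DecidableEq (PBond P j)} (m : ℕ) (f : Fin (m + 1) → Density P j G) (fib : Fin m → Finset (PBond P j))
    (z : Fin m → ℝ) (hm : ∀ k, Measurable (f k)) (hint : ∀ k, Integrable (f k) (fieldMeasure P j G)) (hz : ∀ i, 0 ≤ z i)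
    (hlink : ∀ i : Fin m, ∀ᵐ V ∂fieldMeasure P j G, fibreIntegral (fib i) (f i.castSucc) V ≤ z i * fibreIntegral (fib i) (f i.succ) V)
    (V : GaugeField P j G) :
    fibreIntegral (Finset.univ : Finset (PBond P j)) (f 0) V ≤ (∏ i, z i) * fibreIntegral (Finset.univ : Finset (PBond P j)) (f (Fin.last m)) V := by
  -- the a.e. letters in `ℝ≥0∞`, composed on `univ`
  have hchain := fibreDomAE_chain (iP := iP) (Finset.univ : Finset (PBond P j)) m (fun k => fun W => ENNReal.ofReal (f k W)) fib
    (fun i => ENNReal.ofReal (z i)) (fun i => Finset.subset_univ _) (fun k => ofReal_comp_measurable (hm k)) (fun i => ENNReal.ofReal_ne_top)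
    (fun i => lmarginal_ofReal_le_mul_ae_of_fibreIntegral_le_ae (fib i) (hm _) (hint _) (hz i) (hlink i))
  -- integrate
  have hI := lintegral_le_mul_lintegral_of_lmarginal_le_ae (Finset.univ : Finset (PBond P j)) (ofReal_comp_measurable (hm 0))
    (ofReal_comp_measurable (hm (Fin.last m))) hchain
  rw [← ENNReal.ofReal_prod_of_nonneg fun i _ => hz i] at hI
  -- back to def-R's real letter on `univ` (the right-hand total integral is finite: integrability)
  have hfin : ∫⁻ W, ENNReal.ofReal (f (Fin.last m) W) ∂fieldMeasure P j G ≠ ∞ := (hint (Fin.last m)).lintegral_lt_top.ne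
  have hprod : 0 ≤ ∏ i, z i := Finset.prod_nonneg fun i _ => hz i
  rw [fibreIntegral_univ_eq, fibreIntegral_univ_eq]
  have h := ENNReal.toReal_mono (ENNReal.mul_ne_top ENNReal.ofReal_ne_top hfin) hI
  rwa [ENNReal.toReal_mul, ENNReal.toReal_ofReal hprod] at h

/-- ★★★ **… HENCE THE INTEGRATED DOMINATION** (Bochner integrals, non-negative densities): under the same a.e. chain letters, `∫ f 0 dV ≤ (Π_i z i) · ∫ f m dV` — the version-robust content
of item (a). [bookkeeping] -/
theorem integral_le_prod_mul_integral_of_chainAE {iP : DecidableEq (PBond P j)} (m : ℕ) (f : Fin (m + 1) → Density P j G) (fib : Fin m → Finset (PBond P j))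
    (z : Fin m → ℝ) (hm : ∀ k, Measurable (f k)) (h0 : ∀ k W, 0 ≤ f k W) (hint : ∀ k, Integrable (f k) (fieldMeasure P j G)) (hz : ∀ i, 0 ≤ z i)
    (hlink : ∀ i : Fin m, ∀ᵐ V ∂fieldMeasure P j G, fibreIntegral (fib i) (f i.castSucc) V ≤ z i * fibreIntegral (fib i) (f i.succ) V) :
    ∫ V, f 0 V ∂fieldMeasure P j G ≤ (∏ i, z i) * ∫ V, f (Fin.last m) V ∂fieldMeasure P j G := by
  rcases isEmpty_or_nonempty (GaugeField P j G) with hE | ⟨⟨V⟩⟩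
  · simp [integral_of_isEmpty]
  have h := fibreIntegral_univ_le_of_chainAE m f fib z hm hint hz hlink V
  rw [fibreIntegral_univ_eq, fibreIntegral_univ_eq,
    ← ofReal_integral_eq_lintegral_ofReal (hint 0) (Filter.Eventually.of_forall (h0 0)),
    ← ofReal_integral_eq_lintegral_ofReal (hint (Fin.last m)) (Filter.Eventually.of_forall (h0 (Fin.last m))),
    ENNReal.toReal_ofReal (integral_nonneg (h0 0)), ENNReal.toReal_ofReal (integral_nonneg (h0 (Fin.last m)))] at h
  exact h

end Chain

end YMDAG.UVSplit
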